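import Mathlib
import Literature.AlgebraicTopology.SingularHomology.MayerVietorisFiveLemma
import Literature.AlgebraicTopology.SingularHomology.MayerVietorisIsoRight
import Literature.AlgebraicTopology.SingularHomology.CollapseMap
import Literature.AlgebraicTopology.SingularHomology.TripleSequence
import HarnessLib

/-!
# Mayer–Vietoris for gluing an acyclic open piece: `H₁(U) → H₁(U ∪ W)` is onto with kernel the
# image of `H₁(U ∩ W)`; `Hₖ₊₁(U) ≅ Hₖ₊₁(U ∪ W)` when `Hₖ(U ∩ W) → Hₖ(U)` is injective
(helper for stub `stub_isLefschetzHandlebody_homology` = NF5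
`Literature.Topology.FourManifolds.LefschetzBase.isLefschetzHandlebody_homology`, line
`modp-braid-orbits` r9, crux `ConvexBisection.AcyclicBisectionExists`, item stmt-SmoothPoincare4-10508;
wave 2 / W2-2: the homology ENGINE of Kosinski multi-attachments of 2-handles, algebraic half)

A Kosinski multi-attachment `X = V ∪ H² ∪ ⋯ ∪ H²` of 4-dimensional 2-handles
(`HandleAttachingMap.IsMultiAttachment`, Kosinski 1993 VI §6) is covered by the open sets
`A = jA(V ∖ ⋃ cores)` and `Bᵢ = jBᵢ(D⁴ ∖ S)` (star-shaped, hence acyclic), with `A ∩ Bᵢ ≅ T ∖ S`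
a thickened circle carrying the `i`-th attaching class and the `Bᵢ` pairwise disjoint; its
homology is computed one handle at a time by the following statements about an open cover
`Y = A ∪ B` with `B` acyclic (Hatcher 2002, §2.2 p. 149: the exact Mayer–Vietoris sequence
`Hₙ₊₁(A ∩ B) →φ Hₙ₊₁(A) ⊕ Hₙ₊₁(B) →ψ Hₙ₊₁(Y) →δ Hₙ(A ∩ B) →φ Hₙ(A) ⊕ Hₙ(B)`, the tree's
`mayerVietoris.exact₁/₂/₃_holds`):
* §1 (cover of a type): `surjective_map_of_mono_φ` (`Hₙ₊₁(B) = 0`, `φₙ` injective ⇒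
  `Hₙ₊₁(A) → Hₙ₊₁(Y)` onto), `ker_map_eq_range` (`Hₙ₊₁(B) = 0` ⇒ its kernel is the image of
  `Hₙ₊₁(A ∩ B)`), `mono_map_of_isZero_inter`, `isIso_map_of_isZero_of_mono`, and `φₙ` is injective
  as soon as one component is (`mono_φ_of_mono_left/right`, `mono_φ_zero`);
* §2 (two open subsets `U`, `W` of a space `X`, transported to the inclusions
  `U ∩ W ⊆ U ⊆ U ∪ W`): **`surjective_map_one_union`, `ker_map_one_union`** — for `W`, `U ∩ W`
  path connected and `H₁(W) = 0`, `H₁(U ∪ W) ≅ H₁(U)/⟨image of H₁(U ∩ W)⟩` (the homological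
  shadow of van Kampen with a simply connected piece); **`isIso_map_succ_union`**,
  `mono_map_succ_union` (higher degrees);
* §3 the registered sub-goal stub `stub_multiAttachment_mvStep` (§2 in degree one).

Everything is proved; no named facts, no `sorry`.  References: A. Hatcher, *Algebraic Topology*,
CUP (2002), §2.2 pp. 149–150 [HatcherAT2002]; A. A. Kosinski, *Differential Manifolds* (1993),
VI §6 [Kosinski1993]; R. E. Gompf, A. I. Stipsicz, *4-Manifolds and Kirby Calculus* (1999), §4.4
[GompfStipsicz1999].
-/

noncomputable section

-- the prescribed namespace `Summit.<P>.<Sub>.…` duplicates `SmoothPoincare4` (P = Sub)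
set_option linter.dupNamespace false

open Set Function CategoryTheory CategoryTheory.Limits
open Literature.AlgebraicTopology.SingularHomology

namespace Summit.SmoothPoincare4.SmoothPoincare4.Theorems.AcyclicBisectionExists.ModpBraidOrbits

universe u v

variable (R : Type v) [CommRing R] (M : Type v) [AddCommGroup M] [Module R M]

/-! ## §1 Mayer–Vietoris for a cover `Y = int A ∪ int B` with `B` acyclic -/

section Cover

variable {Y : Type u} [TopologicalSpace Y] (A B : Set Y)

/-- `inl : P ⟶ P ⊞ Q` is an isomorphism when `Q = 0`. [folklore] -/
theorem isIso_biprod_inl_of_isZero {C : Type*} [Category C] [Preadditive C] {P Q : C}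
    [HasBinaryBiproduct P Q] (hQ : IsZero Q) : IsIso (biprod.inl : P ⟶ P ⊞ Q) := by
  refine ⟨⟨biprod.fst, biprod.inl_fst, ?_⟩⟩
  refine biprod.hom_ext' _ _ ?_ ?_
  · rw [biprod.inl_fst_assoc, Category.comp_id]
  · exact hQ.eq_of_src _ _

/-- `φₙ` is injective as soon as its first component `Hₙ(A ∩ B) → Hₙ(A)` is.
[cite: HatcherAT2002, §2.2 p. 149] -/
theorem mono_φ_of_mono_left (n : ℕ)
    [Mono (singularHomology.map R M (subsetInclusion (inter_subset_left : A ∩ B ⊆ A)) n)] :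
    Mono (mayerVietoris.φ R M A B n) := by
  have hfac : mayerVietoris.φ R M A B n ≫ biprod.fst =
      singularHomology.map R M (subsetInclusion (inter_subset_left : A ∩ B ⊆ A)) n :=
    biprod.lift_fst _ _
  haveI : Mono (mayerVietoris.φ R M A B n ≫ biprod.fst) := by rw [hfac]; infer_instance
  exact mono_of_mono _ (biprod.fst : singularHomology R M A n ⊞ singularHomology R M B n ⟶ _)

/-- `φₙ` is injective as soon as its second component `Hₙ(A ∩ B) → Hₙ(B)` is.
[cite: HatcherAT2002, §2.2 p. 149] -/
theorem mono_φ_of_mono_right (n : ℕ)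
    [Mono (singularHomology.map R M (subsetInclusion (inter_subset_right : A ∩ B ⊆ B)) n)] :
    Mono (mayerVietoris.φ R M A B n) := by
  have hfac : mayerVietoris.φ R M A B n ≫ (-biprod.snd) =
      singularHomology.map R M (subsetInclusion (inter_subset_right : A ∩ B ⊆ B)) n := by
    rw [Preadditive.comp_neg, mayerVietoris.φ, biprod.lift_snd, neg_neg]
  haveI : Mono (mayerVietoris.φ R M A B n ≫ (-biprod.snd)) := by rw [hfac]; infer_instance
  exact mono_of_mono _ (-(biprod.snd : singularHomology R M A n ⊞ singularHomology R M B n ⟶ _))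

/-- `φ₀` is injective when `A ∩ B` and `B` are path connected. [cite: HatcherAT2002, §2.2 p. 149] -/
theorem mono_φ_zero [PathConnectedSpace ↥(A ∩ B)] [PathConnectedSpace ↥B] :
    Mono (mayerVietoris.φ R M A B 0) := by
  haveI := singularHomology.isIso_map_zero_of_pathConnectedSpace R M
    (subsetInclusion (inter_subset_right : A ∩ B ⊆ B))
  exact mono_φ_of_mono_right R M A B 0

/-- If `φₙ` is injective then `δₙ = 0` and `ψₙ₊₁` is onto. [cite: HatcherAT2002, §2.2 p. 149] -/
theorem epi_ψ_of_mono_φ (hAB : interior A ∪ interior B = univ) (n : ℕ)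
    [Mono (mayerVietoris.φ R M A B n)] : Epi (mayerVietoris.ψ R M A B (n + 1)) := by
  have hexc := relativeSingularHomology.isIso_map_of_interior_union_interior_holds R M Y
  have hδ : mayerVietoris.δ R M A B hexc hAB n = 0 :=
    (cancel_mono (mayerVietoris.φ R M A B n)).1
      ((mayerVietoris.δ_comp_φ R M A B hexc hAB n).trans (zero_comp).symm)
  exact (mayerVietoris.exact₂_holds R M A B hexc hAB n).epi_f hδ

/-- **`Hₙ₊₁(A) → Hₙ₊₁(Y)` is onto** when `Hₙ₊₁(B) = 0` and `φₙ` is injective: `ψₙ₊₁` is onto and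
its `B`-summand vanishes. [cite: HatcherAT2002, §2.2 p. 149] -/
theorem surjective_map_of_mono_φ (hAB : interior A ∪ interior B = univ) (n : ℕ)
    (hB : IsZero (singularHomology R M ↥B (n + 1))) [Mono (mayerVietoris.φ R M A B n)] :
    Function.Surjective (singularHomology.map R M (subsetIncl A) (n + 1)) := by
  haveI := epi_ψ_of_mono_φ R M A B hAB n
  intro y
  obtain ⟨x, rfl⟩ := (ModuleCat.epi_iff_surjective (mayerVietoris.ψ R M A B (n + 1))).1
    inferInstance y
  refine ⟨(biprod.fst : singularHomology R M A (n + 1) ⊞ singularHomology R M B (n + 1) ⟶ _) x, ?_⟩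
  conv_rhs => rw [← biprod_apply_decomp x]
  rw [map_add, mayerVietoris.ψ, biprod_desc_inl_apply, biprod_desc_inr_apply,
    hB.eq_of_src (singularHomology.map R M (subsetIncl B) (n + 1)) 0]
  simp

/-- The two inclusions `A ∩ B ⊆ A ⊆ Y` and `A ∩ B ⊆ B ⊆ Y` agree. [folklore] -/
theorem subsetIncl_comp_inter_left_eq :
    (subsetIncl A).comp (subsetInclusion (inter_subset_left : A ∩ B ⊆ A)) =
      (subsetIncl B).comp (subsetInclusion (inter_subset_right : A ∩ B ⊆ B)) := by
  ext x; rfl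

/-- **The kernel of `Hₙ₊₁(A) → Hₙ₊₁(Y)` is the image of `Hₙ₊₁(A ∩ B) → Hₙ₊₁(A)`** when
`Hₙ₊₁(B) = 0` (exactness at `Hₙ₊₁(A) ⊕ Hₙ₊₁(B)`). [cite: HatcherAT2002, §2.2 p. 149] -/
theorem ker_map_eq_range (hAB : interior A ∪ interior B = univ) (n : ℕ)
    (hB : IsZero (singularHomology R M ↥B (n + 1))) :
    LinearMap.ker (singularHomology.map R M (subsetIncl A) (n + 1)).hom =
      LinearMap.range (singularHomology.map R M
        (subsetInclusion (inter_subset_left : A ∩ B ⊆ A)) (n + 1)).hom := by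
  apply le_antisymm
  · intro a ha
    have hex := mayerVietoris.exact₁_holds R M A B hAB (n + 1)
    have h0 : mayerVietoris.ψ R M A B (n + 1)
        ((biprod.inl : singularHomology R M A (n + 1) ⟶ _ ⊞ singularHomology R M B (n + 1)) a)
          = 0 := by
      rw [mayerVietoris.ψ, biprod_desc_inl_apply]; exact ha
    obtain ⟨c, hc⟩ := (ShortComplex.moduleCat_exact_iff _).1 hex _ h0
    change mayerVietoris.φ R M A B (n + 1) c = _ at hc
    refine ⟨c, ?_⟩
    have e := congrArg (biprod.fst : singularHomology R M A (n + 1) ⊞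
      singularHomology R M B (n + 1) ⟶ _) hc
    rw [mayerVietoris.φ, biprod_fst_lift_apply, ← ModuleCat.comp_apply, biprod.inl_fst,
      ModuleCat.id_apply] at e
    exact e
  · rintro _ ⟨c, rfl⟩
    show (singularHomology.map R M (subsetInclusion inter_subset_left) (n + 1) ≫
      singularHomology.map R M (subsetIncl A) (n + 1)) c = 0
    rw [← singularHomology.map_comp, subsetIncl_comp_inter_left_eq, singularHomology.map_comp,
      hB.eq_of_src (singularHomology.map R M (subsetIncl B) (n + 1)) 0, comp_zero]
    rfl

/-- **`Hₙ₊₁(A) → Hₙ₊₁(Y)` is injective when `Hₙ₊₁(A ∩ B) = 0`.** [cite: HatcherAT2002, §2.2 p. 149] -/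
theorem mono_map_of_isZero_inter (hAB : interior A ∪ interior B = univ) (n : ℕ)
    (hI : IsZero (singularHomology R M ↥(A ∩ B) (n + 1))) :
    Mono (singularHomology.map R M (subsetIncl A) (n + 1)) := by
  have hφ0 : mayerVietoris.φ R M A B (n + 1) = 0 := hI.eq_of_src _ _
  haveI : Mono (mayerVietoris.ψ R M A B (n + 1)) :=
    (mayerVietoris.exact₁_holds R M A B hAB (n + 1)).mono_g hφ0
  have hfac : singularHomology.map R M (subsetIncl A) (n + 1) =
      biprod.inl ≫ mayerVietoris.ψ R M A B (n + 1) := (biprod.inl_desc _ _).symm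
  rw [hfac]
  exact mono_comp _ _

/-- **`Hₖ₊₁(A) ≅ Hₖ₊₁(Y)`** when `Hₖ₊₁(A ∩ B) = 0`, `Hₖ₊₁(B) = 0` and `Hₖ(A ∩ B) → Hₖ(A)` is
injective (`ψₖ₊₁` is an isomorphism and `Hₖ₊₁(A) = Hₖ₊₁(A) ⊕ Hₖ₊₁(B)`); companion of the tree's
`mayerVietoris.isIso_map_right_of_isZero` with the injectivity on the surviving piece.
[cite: HatcherAT2002, §2.2 p. 149] -/
theorem isIso_map_of_isZero_of_mono (hAB : interior A ∪ interior B = univ) (k : ℕ)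
    (hI : IsZero (singularHomology R M ↥(A ∩ B) (k + 1)))
    (hB : IsZero (singularHomology R M ↥B (k + 1)))
    [Mono (singularHomology.map R M (subsetInclusion (inter_subset_left : A ∩ B ⊆ A)) k)] :
    IsIso (singularHomology.map R M (subsetIncl A) (k + 1)) := by
  haveI := mono_φ_of_mono_left R M A B k
  haveI := epi_ψ_of_mono_φ R M A B hAB k
  have hφ0 : mayerVietoris.φ R M A B (k + 1) = 0 := hI.eq_of_src _ _
  haveI : Mono (mayerVietoris.ψ R M A B (k + 1)) :=
    (mayerVietoris.exact₁_holds R M A B hAB (k + 1)).mono_g hφ0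
  haveI : IsIso (mayerVietoris.ψ R M A B (k + 1)) := isIso_of_mono_of_epi _
  haveI := isIso_biprod_inl_of_isZero (P := singularHomology R M A (k + 1)) hB
  have hfac : singularHomology.map R M (subsetIncl A) (k + 1) =
      biprod.inl ≫ mayerVietoris.ψ R M A B (k + 1) := (biprod.inl_desc _ _).symm
  rw [hfac]
  infer_instance

end Cover

/-! ## §2 Two open subsets `U`, `W` of a space: transport to the inclusions of subsets -/

variable {R} in
/-- Transport of "kernel = image" along linear isomorphisms: if `F = F' ∘ e⁻¹`,
`e ∘ G' = G ∘ eI` and `ker F' = range G'` then `ker F = range G`. [folklore] -/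
theorem ker_eq_range_of_conj {P P' Q I I' : Type*} [AddCommGroup P] [Module R P]
    [AddCommGroup P'] [Module R P'] [AddCommGroup Q] [Module R Q] [AddCommGroup I] [Module R I]
    [AddCommGroup I'] [Module R I'] (e : P' ≃ₗ[R] P) (eI : I' ≃ₗ[R] I) {F : P →ₗ[R] Q}
    {F' : P' →ₗ[R] Q} {G : I →ₗ[R] P} {G' : I' →ₗ[R] P'}
    (hF : F = F' ∘ₗ (e.symm : P →ₗ[R] P')) (hG : (e : P' →ₗ[R] P) ∘ₗ G' = G ∘ₗ (eI : I' →ₗ[R] I))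
    (h : LinearMap.ker F' = LinearMap.range G') : LinearMap.ker F = LinearMap.range G := by
  have h1 : LinearMap.ker F = Submodule.map (e : P' →ₗ[R] P) (LinearMap.ker F') := by
    rw [hF, LinearMap.ker_comp, ← Submodule.map_equiv_eq_comap_symm]
  rw [h1, h, LinearMap.range_eq_map, ← Submodule.map_comp, hG, Submodule.map_comp,
    Submodule.map_top, LinearEquiv.range, Submodule.map_top]

section Subsets

variable {X : Type u} [TopologicalSpace X] {U W : Set X}

/-- The traces of the open `U`, `W` on `U ∪ W` are open pieces covering it. [folklore] -/
theorem interior_union_interior_eq_univ (hU : IsOpen U) (hW : IsOpen W) :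
    interior (Subtype.val ⁻¹' U : Set ↥(U ∪ W)) ∪ interior (Subtype.val ⁻¹' W) = univ := by
  rw [(hU.preimage continuous_subtype_val).interior_eq,
    (hW.preimage continuous_subtype_val).interior_eq]
  ext x
  simp only [mem_union, mem_preimage, mem_univ, iff_true]
  exact x.2

section Traces

variable (U W) in
/-- The trace `val ⁻¹' U` of `U` on `U ∪ W`, identified with `U`. [folklore] -/
private def eU : ↥(Subtype.val ⁻¹' U : Set ↥(U ∪ W)) ≃ₜ ↥U :=
  preimageValHomeomorphOfSubset subset_union_left

variable (U W) in
/-- The trace `val ⁻¹' W` of `W` on `U ∪ W`, identified with `W`. [folklore] -/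
private def eW : ↥(Subtype.val ⁻¹' W : Set ↥(U ∪ W)) ≃ₜ ↥W :=
  preimageValHomeomorphOfSubset subset_union_right

variable (U W) in
/-- The trace of `U ∩ W` on `U ∪ W`, identified with `U ∩ W`. [folklore] -/
private def eUW : ↥((Subtype.val ⁻¹' U : Set ↥(U ∪ W)) ∩ Subtype.val ⁻¹' W) ≃ₜ ↥(U ∩ W) :=
  preimageValHomeomorphOfSubset (A := U ∪ W) (B := U ∩ W)
    (inter_subset_left.trans subset_union_left)

variable (U W) in
/-- `incl_{val⁻¹'U} ∘ eU⁻¹ = (U ⊆ U ∪ W)`. [folklore] -/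
theorem subsetIncl_comp_eU_symm :
    (subsetIncl (Subtype.val ⁻¹' U : Set ↥(U ∪ W))).comp
        ((eU U W).symm : C(↥U, ↥(Subtype.val ⁻¹' U : Set ↥(U ∪ W)))) =
      subsetInclusion (subset_union_left : U ⊆ U ∪ W) := by
  ext x; rfl

variable (U W) in
/-- `eU ∘ (traces of U ∩ W ⊆ U) = (U ∩ W ⊆ U) ∘ eUW`. [folklore] -/
theorem eU_comp_subsetInclusion :
    ((eU U W : C(_, ↥U))).comp (subsetInclusion (inter_subset_left :
        (Subtype.val ⁻¹' U : Set ↥(U ∪ W)) ∩ Subtype.val ⁻¹' W ⊆ Subtype.val ⁻¹' U)) =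
      (subsetInclusion (inter_subset_left : U ∩ W ⊆ U)).comp (eUW U W : C(_, ↥(U ∩ W))) := by
  ext x; rfl


/-- On homology: `(U ⊆ U ∪ W)_* = eU⁻¹_* ≫ (incl_{val⁻¹'U})_*`. [folklore] -/
theorem map_union_left_eq (n : ℕ) :
    singularHomology.map R M (subsetInclusion (subset_union_left : U ⊆ U ∪ W)) n =
      (singularHomology.mapIso R M (eU U W) n).inv ≫
        singularHomology.map R M (subsetIncl (Subtype.val ⁻¹' U : Set ↥(U ∪ W))) n := by
  rw [singularHomology.mapIso_inv, ← singularHomology.map_comp, subsetIncl_comp_eU_symm]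

/-- On homology: `(traces)_* ≫ eU_* = eUW_* ≫ (U ∩ W ⊆ U)_*`. [folklore] -/
theorem map_trace_left_comm (n : ℕ) :
    singularHomology.map R M (subsetInclusion (inter_subset_left :
        (Subtype.val ⁻¹' U : Set ↥(U ∪ W)) ∩ Subtype.val ⁻¹' W ⊆ Subtype.val ⁻¹' U)) n ≫
        (singularHomology.mapIso R M (eU U W) n).hom =
      (singularHomology.mapIso R M (eUW U W) n).hom ≫
        singularHomology.map R M (subsetInclusion (inter_subset_left : U ∩ W ⊆ U)) n := by
  rw [singularHomology.mapIso_hom, singularHomology.mapIso_hom, ← singularHomology.map_comp,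
    ← singularHomology.map_comp, eU_comp_subsetInclusion]

/-- Injectivity on `Hₙ` of the trace of `U ∩ W ⊆ U` from that of `U ∩ W ⊆ U`. [folklore] -/
theorem mono_map_trace_left (n : ℕ)
    [Mono (singularHomology.map R M (subsetInclusion (inter_subset_left : U ∩ W ⊆ U)) n)] :
    Mono (singularHomology.map R M (subsetInclusion (inter_subset_left :
      (Subtype.val ⁻¹' U : Set ↥(U ∪ W)) ∩ Subtype.val ⁻¹' W ⊆ Subtype.val ⁻¹' U)) n) := by
  haveI : Mono ((singularHomology.mapIso R M (eUW U W) n).hom ≫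
      singularHomology.map R M (subsetInclusion (inter_subset_left : U ∩ W ⊆ U)) n) :=
    mono_comp _ _
  haveI : Mono (singularHomology.map R M (subsetInclusion (inter_subset_left :
      (Subtype.val ⁻¹' U : Set ↥(U ∪ W)) ∩ Subtype.val ⁻¹' W ⊆ Subtype.val ⁻¹' U)) n ≫
        (singularHomology.mapIso R M (eU U W) n).hom) := by
    rw [map_trace_left_comm]; infer_instance
  exact mono_of_mono _ (singularHomology.mapIso R M (eU U W) n).hom

/-- Path connectedness of the trace of `U ∩ W`. [folklore] -/
theorem pathConnectedSpace_trace_inter [PathConnectedSpace ↥(U ∩ W)] :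
    PathConnectedSpace ↥((Subtype.val ⁻¹' U : Set ↥(U ∪ W)) ∩ Subtype.val ⁻¹' W) :=
  (eUW U W).symm.surjective.pathConnectedSpace (eUW U W).symm.continuous

/-- Path connectedness of the trace of `W`. [folklore] -/
theorem pathConnectedSpace_trace_right [PathConnectedSpace ↥W] :
    PathConnectedSpace ↥(Subtype.val ⁻¹' W : Set ↥(U ∪ W)) :=
  (eW U W).symm.surjective.pathConnectedSpace (eW U W).symm.continuous
/-- Vanishing of the homology of the trace of `W` from that of `W`. [folklore] -/
theorem isZero_trace_right {n : ℕ} (hW : IsZero (singularHomology R M ↥W n)) :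
    IsZero (singularHomology R M ↥(Subtype.val ⁻¹' W : Set ↥(U ∪ W)) n) :=
  hW.of_iso (singularHomology.mapIso R M (eW U W) n)

/-- Vanishing of the homology of the trace of `U ∩ W` from that of `U ∩ W`. [folklore] -/
theorem isZero_trace_inter {n : ℕ} (hUW : IsZero (singularHomology R M ↥(U ∩ W) n)) :
    IsZero (singularHomology R M ↥((Subtype.val ⁻¹' U : Set ↥(U ∪ W)) ∩ Subtype.val ⁻¹' W) n) :=
  hUW.of_iso (singularHomology.mapIso R M (eUW U W) n)

/-- **`H₁(U; M) → H₁(U ∪ W; M)` is onto** for open `U`, `W` with `W`, `U ∩ W` path connected and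
`H₁(W; M) = 0`. [cite: HatcherAT2002, §2.2 p. 149] -/
theorem surjective_map_one_union (hU : IsOpen U) (hW : IsOpen W) [PathConnectedSpace ↥(U ∩ W)]
    [PathConnectedSpace ↥W] (hW1 : IsZero (singularHomology R M ↥W 1)) :
    Function.Surjective
      (singularHomology.map R M (subsetInclusion (subset_union_left : U ⊆ U ∪ W)) 1) := by
  haveI := pathConnectedSpace_trace_inter (U := U) (W := W)
  haveI := pathConnectedSpace_trace_right (U := U) (W := W)
  haveI := mono_φ_zero R M (Subtype.val ⁻¹' U : Set ↥(U ∪ W)) (Subtype.val ⁻¹' W)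
  have hs : Function.Surjective (singularHomology.map R M
      (subsetIncl (Subtype.val ⁻¹' U : Set ↥(U ∪ W))) 1) :=
    surjective_map_of_mono_φ R M (Subtype.val ⁻¹' U : Set ↥(U ∪ W)) (Subtype.val ⁻¹' W)
      (interior_union_interior_eq_univ hU hW) 0 (isZero_trace_right R M hW1)
  have he : Function.Surjective ((singularHomology.mapIso R M (eU U W) 1).inv) := fun a =>
    ⟨(singularHomology.mapIso R M (eU U W) 1).hom a,
      (singularHomology.mapIso R M (eU U W) 1).hom_inv_id_apply a⟩
  intro y
  obtain ⟨a, rfl⟩ := hs y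
  obtain ⟨u, rfl⟩ := he a
  exact ⟨u, by rw [map_union_left_eq, ModuleCat.comp_apply]⟩

/-- **The kernel of `H₁(U; M) → H₁(U ∪ W; M)` is the image of `H₁(U ∩ W; M) → H₁(U; M)`** for
open `U`, `W` with `H₁(W; M) = 0`; so `H₁(U ∪ W) ≅ H₁(U) ⧸ ⟨H₁(U ∩ W)⟩` together with
`surjective_map_one_union`. [cite: HatcherAT2002, §2.2 p. 149] -/
theorem ker_map_one_union (hU : IsOpen U) (hW : IsOpen W)
    (hW1 : IsZero (singularHomology R M ↥W 1)) :
    LinearMap.ker (singularHomology.map R M (subsetInclusion (subset_union_left : U ⊆ U ∪ W)) 1).hom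
      = LinearMap.range (singularHomology.map R M
          (subsetInclusion (inter_subset_left : U ∩ W ⊆ U)) 1).hom := by
  have hk := ker_map_eq_range R M (Subtype.val ⁻¹' U : Set ↥(U ∪ W)) (Subtype.val ⁻¹' W)
    (interior_union_interior_eq_univ hU hW) 0 (isZero_trace_right R M hW1)
  refine ker_eq_range_of_conj (singularHomology.mapIso R M (eU U W) 1).toLinearEquiv
    (singularHomology.mapIso R M (eUW U W) 1).toLinearEquiv ?_ ?_ hk
  · have e := congrArg ModuleCat.Hom.hom (map_union_left_eq R M (U := U) (W := W) 1)
    rw [ModuleCat.hom_comp] at e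
    exact e
  · have e := congrArg ModuleCat.Hom.hom (map_trace_left_comm R M (U := U) (W := W) 1)
    rw [ModuleCat.hom_comp, ModuleCat.hom_comp] at e
    exact e

/-- **`Hₖ₊₁(U; M) ≅ Hₖ₊₁(U ∪ W; M)`** for open `U`, `W` with `Hₖ₊₁(U ∩ W) = 0`, `Hₖ₊₁(W) = 0`
and `Hₖ(U ∩ W) → Hₖ(U)` injective. [cite: HatcherAT2002, §2.2 p. 149] -/
theorem isIso_map_succ_union (hU : IsOpen U) (hW : IsOpen W) (k : ℕ)
    (hI : IsZero (singularHomology R M ↥(U ∩ W) (k + 1)))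
    (hWk : IsZero (singularHomology R M ↥W (k + 1)))
    [Mono (singularHomology.map R M (subsetInclusion (inter_subset_left : U ∩ W ⊆ U)) k)] :
    IsIso (singularHomology.map R M (subsetInclusion (subset_union_left : U ⊆ U ∪ W)) (k + 1)) := by
  haveI := mono_map_trace_left R M (U := U) (W := W) k
  haveI := isIso_map_of_isZero_of_mono R M (Subtype.val ⁻¹' U : Set ↥(U ∪ W))
    (Subtype.val ⁻¹' W) (interior_union_interior_eq_univ hU hW) k (isZero_trace_inter R M hI)
    (isZero_trace_right R M hWk)
  rw [map_union_left_eq]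
  infer_instance

/-- **`Hₖ₊₁(U; M) → Hₖ₊₁(U ∪ W; M)` is injective** for open `U`, `W` with `Hₖ₊₁(U ∩ W) = 0`.
[cite: HatcherAT2002, §2.2 p. 149] -/
theorem mono_map_succ_union (hU : IsOpen U) (hW : IsOpen W) (k : ℕ)
    (hI : IsZero (singularHomology R M ↥(U ∩ W) (k + 1))) :
    Mono (singularHomology.map R M (subsetInclusion (subset_union_left : U ⊆ U ∪ W)) (k + 1)) := by
  haveI := mono_map_of_isZero_inter R M (Subtype.val ⁻¹' U : Set ↥(U ∪ W)) (Subtype.val ⁻¹' W)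
    (interior_union_interior_eq_univ hU hW) k (isZero_trace_inter R M hI)
  rw [map_union_left_eq]
  exact mono_comp _ _

end Traces

end Subsets

/-! ## §3 The registered sub-goal stub -/

/-- **Mayer–Vietoris step for one acyclic open piece** (registered sub-goal stub
`stub_multiAttachment_mvStep` of `stub_isLefschetzHandlebody_homology`): for open `U`, `W` with
`W`, `U ∩ W` path connected and `H₁(W; R) = 0`, the map `H₁(U; R) → H₁(U ∪ W; R)` is onto and its
kernel is the image of `H₁(U ∩ W; R)`, i.e. `H₁(U ∪ W) ≅ H₁(U) ⧸ ⟨H₁(U ∩ W)⟩` — applied to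
`U = jA(V ∖ ⋃ cores) ∪ (handles so far)`, `W = jBᵢ(D⁴ ∖ S)` this is
`H₁(X ∪ H²) = H₁(X)/⟨attaching circle⟩` (Gompf–Stipsicz 1999, §4.4). [cite: HatcherAT2002, §2.2 p. 149] -/
theorem stub_multiAttachment_mvStep : ∀ (R : Type) [CommRing R] (X : Type) [TopologicalSpace X]
    (U W : Set X), IsOpen U → IsOpen W → PathConnectedSpace ↥(U ∩ W) → PathConnectedSpace ↥W →
    CategoryTheory.Limits.IsZero
      (Literature.AlgebraicTopology.SingularHomology.singularHomology R R ↥W 1) →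
    Function.Surjective (Literature.AlgebraicTopology.SingularHomology.singularHomology.map R R
      (Literature.AlgebraicTopology.SingularHomology.subsetInclusion
        (Set.subset_union_left : U ⊆ U ∪ W)) 1) ∧
    LinearMap.ker (Literature.AlgebraicTopology.SingularHomology.singularHomology.map R R
      (Literature.AlgebraicTopology.SingularHomology.subsetInclusion
        (Set.subset_union_left : U ⊆ U ∪ W)) 1).hom =
      LinearMap.range (Literature.AlgebraicTopology.SingularHomology.singularHomology.map R R
        (Literature.AlgebraicTopology.SingularHomology.subsetInclusion
          (Set.inter_subset_left : U ∩ W ⊆ U)) 1).hom :=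
  fun R _ _ _ _ _ hU hW _ _ hW1 =>
    ⟨surjective_map_one_union R R hU hW hW1, ker_map_one_union R R hU hW hW1⟩

end Summit.SmoothPoincare4.SmoothPoincare4.Theorems.AcyclicBisectionExists.ModpBraidOrbits
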